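import Literature.Combinatorics.SimpleGraph.HamiltonianGadgetForcing
import Mathlib.Data.Fintype.Prod
import Mathlib.Tactic.FinCases
import Mathlib.Tactic.IntervalCases
import HarnessLib

/-!
# Gadget substitution for Hamiltonian-path counts, V: the subdivided ladder (an XOR-gadget of maximum degree three)

The gadget framework (`HamiltonianGadgetSubstitution*.lean`) instantiated on a first template:
the **subdivided ladder** — two rails `rail r 0 … rail r 3` (`r = false, true`), rungs
`rail false i – mid i – rail true i`, and four port edges `port r true – rail r 0`,
`port r false – rail r 3`. Its two slots are `(port r true, port r false)`.

Because every `mid i` has degree two, any family of port-to-port strands covering the twelve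
gadget vertices is forced (`Ladder.family_classification`): it consists of the single zigzag
`zigzag r` from `port r true` to `port r false` for one side `r` (in one of its two
orientations). Hence the ladder is an **exclusive** gadget (`Ladder.exclusive`) with census
`N{slot r} = 1` (`Ladder.coverSet_single`, `Ladder.coverCount_single`) and `N ∅ = N S = 0`
(`Ladder.coverCount_empty`, `Ladder.coverCount_pair`): substituted for two slot edges `e, f` of a
graph, it multiplies the number of Hamiltonian paths using exactly one of `e, f` by `1` and kills
all others — the rôle of the XOR-gadget of Garey–Johnson–Tarjan 1976 / Liśkiewicz–Ogihara–Toda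
2003 (§3, "to go through all the nodes in an XOR-gadget one has to enter and exit on the same
vertical axis"), in a variant for graphs of maximum degree three (census `1` instead of `2¹²`).

## References

* M. R. Garey, D. S. Johnson, R. E. Tarjan, SIAM J. Comput. 5 (1976) 704–714, §2.
* M. Liśkiewicz, M. Ogihara, S. Toda, TCS 304 (2003) 129–156, §3.
-/

namespace Literature.Combinatorics.SimpleGraph

open scoped Classical

/-! ### The template -/

/-- The sixteen vertices of the subdivided ladder: rail vertices `rail r i`, rung midpoints
`mid i`, ports `port r top`. [folklore] -/
inductive LadderV
  | rail (r : Bool) (i : Fin 4)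
  | mid (i : Fin 4)
  | port (r : Bool) (top : Bool)
  deriving DecidableEq, Repr

namespace LadderV

/-- All vertices. [folklore] -/
def all : List LadderV :=
  [rail false 0, rail false 1, rail false 2, rail false 3, rail true 0, rail true 1, rail true 2, rail true 3,
   mid 0, mid 1, mid 2, mid 3, port false false, port false true, port true false, port true true]

/-- The sixteen vertices form a finite type (explicit enumeration). [folklore] -/
instance : Fintype LadderV where
  elems := ⟨all, by decide⟩
  complete := by
    intro x
    rcases x with ⟨r, i⟩ | i | ⟨r, t⟩
    · cases r <;> fin_cases i <;> decide
    · fin_cases i <;> decide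
    · cases r <;> cases t <;> decide

/-- Ports. [folklore] -/
def isPort : LadderV → Bool
  | port _ _ => true
  | _ => false

/-- The edges of the subdivided ladder, as a Boolean relation. [folklore] -/
def adjB : LadderV → LadderV → Bool
  | rail r i, rail r' j => r == r' && (i.val + 1 == j.val || j.val + 1 == i.val)
  | rail _ i, mid j => i == j
  | mid j, rail _ i => i == j
  | port r top, rail r' i => r == r' && (if top then i.val == 0 else i.val == 3)
  | rail r' i, port r top => r == r' && (if top then i.val == 0 else i.val == 3)
  | _, _ => false

end LadderV

open LadderV

/-- **The subdivided ladder** (rails, subdivided rungs, port edges). [folklore] -/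
def ladderG : _root_.SimpleGraph LadderV :=
  _root_.SimpleGraph.fromRel fun a b => adjB a b = true

/-- Adjacency in the ladder is decidable. [folklore] -/
instance : DecidableRel ladderG.Adj := fun a b =>
  inferInstanceAs (Decidable (a ≠ b ∧ (adjB a b = true ∨ adjB b a = true)))

/-- The gadget vertices: everything but the ports. [folklore] -/
def ladderVX : Finset LadderV :=
  Finset.univ.filter fun v => isPort v = false

/-- The slot of side `r`: from its top port to its bottom port. [folklore] -/
def Ladder.slot (r : Bool) : LadderV × LadderV :=
  (port r true, port r false)

/-- The two slots. [folklore] -/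
def ladderS : Finset (LadderV × LadderV) :=
  {Ladder.slot false, Ladder.slot true}

/-- **The zigzag of side `r`**: the Hamiltonian path of the gadget vertices from `rail r 0` to
`rail r 3`. [folklore] -/
def zigzag (r : Bool) : List LadderV :=
  [rail r 0, mid 0, rail (!r) 0, rail (!r) 1, mid 1, rail r 1, rail r 2, mid 2, rail (!r) 2, rail (!r) 3, mid 3,
    rail r 3]

/-- The cover realising the slot of side `r`: the zigzag. [folklore] -/
def Ladder.coverOf (r : Bool) (e : LadderV × LadderV) : List LadderV :=
  if e = Ladder.slot r then zigzag r else []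

namespace Ladder

/-! ### Finite facts about the template -/

/-- Membership in the gadget vertex set. [folklore] -/
theorem mem_ladderVX {v : LadderV} : v ∈ ladderVX ↔ isPort v = false := by
  simp [ladderVX]

/-- Rung midpoints are gadget vertices. [folklore] -/
theorem mid_mem (i : Fin 4) : mid i ∈ ladderVX := mem_ladderVX.2 rfl

/-- Rail vertices are gadget vertices. [folklore] -/
theorem rail_mem (r : Bool) (i : Fin 4) : rail r i ∈ ladderVX := mem_ladderVX.2 rfl

/-- Ports are not gadget vertices. [folklore] -/
theorem port_not_mem (r t : Bool) : port r t ∉ ladderVX := by simp [mem_ladderVX, isPort]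

/-- A vertex flagged as a port is a port. [folklore] -/
theorem eq_port_of_isPort {p : LadderV} (h : isPort p = true) : ∃ r t, p = port r t := by
  cases p <;> simp_all [isPort]

/-- The neighbours of a rung midpoint. [folklore] -/
theorem nbr_mid : ∀ (i : Fin 4) (y : LadderV), ladderG.Adj (mid i) y → y = rail false i ∨ y = rail true i := by
  decide

/-- The neighbours of the first rail vertex. [folklore] -/
theorem nbr_rail0 : ∀ (r : Bool) (y : LadderV), ladderG.Adj (rail r 0) y → y = mid 0 ∨ y = rail r 1 ∨ y = port r true := by
  decide

/-- The neighbours of the second rail vertex. [folklore] -/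
theorem nbr_rail1 : ∀ (r : Bool) (y : LadderV), ladderG.Adj (rail r 1) y → y = mid 1 ∨ y = rail r 0 ∨ y = rail r 2 := by
  decide

/-- The neighbours of the third rail vertex. [folklore] -/
theorem nbr_rail2 : ∀ (r : Bool) (y : LadderV), ladderG.Adj (rail r 2) y → y = mid 2 ∨ y = rail r 1 ∨ y = rail r 3 := by
  decide

/-- The neighbours of the last rail vertex. [folklore] -/
theorem nbr_rail3 : ∀ (r : Bool) (y : LadderV), ladderG.Adj (rail r 3) y → y = mid 3 ∨ y = rail r 2 ∨ y = port r false := by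
  decide

/-- The neighbour of a top port. [folklore] -/
theorem nbr_port_top : ∀ (r : Bool) (y : LadderV), ladderG.Adj (port r true) y → y = rail r 0 := by
  decide

/-- The neighbour of a bottom port. [folklore] -/
theorem nbr_port_bot : ∀ (r : Bool) (y : LadderV), ladderG.Adj (port r false) y → y = rail r 3 := by
  decide

/-- The ports of the two slots. [folklore] -/
theorem ports_ladderS : ports ladderS = {port false true, port false false, port true true, port true false} := by
  decide

/-- The ports of one slot. [folklore] -/
theorem ports_single (r : Bool) : ports ({slot r} : Finset (LadderV × LadderV)) = {port r true, port r false} := by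
  cases r <;> decide

/-! ### Analysis of a strand family of the ladder -/

section analysis

variable {P : Finset LadderV} {T : Set (LadderV × List LadderV × LadderV)}
  (hT : StrandFamily ladderG ladderVX P T)
include hT

/-- Every rung is used: `mid i` is linked to both its rail neighbours and to nothing else.
[folklore] -/
theorem mid_links (i : Fin 4) :
    Link T (mid i) (rail false i) ∧ Link T (mid i) (rail true i) ∧
      ∀ y, Link T (mid i) y → y = rail false i ∨ y = rail true i :=
  hT.links_of_adj_two (mid_mem i) (nbr_mid i)

/-- Every rail vertex is linked to its rung midpoint. [folklore] -/
theorem rail_mid (r : Bool) (i : Fin 4) : Link T (rail r i) (mid i) := by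
  cases r
  · exact link_comm.1 (mid_links hT i).1
  · exact link_comm.1 (mid_links hT i).2.1

/-- The rail edge `0–1` of side `r` is used iff the top port of side `r` is not. [folklore] -/
theorem u0_iff (r : Bool) : Link T (rail r 0) (rail r 1) ↔ ¬ Link T (port r true) (rail r 0) := by
  rw [hT.link_iff_not_link_of_adj_three (rail_mem r 0) (nbr_rail0 r) (by simp) (by simp) (by simp)
    (rail_mid hT r 0), link_comm]

/-- The rail edge `1–2` of side `r` is used iff the top port of side `r` is. [folklore] -/
theorem u1_iff (r : Bool) : Link T (rail r 1) (rail r 2) ↔ Link T (port r true) (rail r 0) := by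
  have h := hT.link_iff_not_link_of_adj_three (rail_mem r 1) (nbr_rail1 r) (by simp) (by simp) (by simp)
    (rail_mid hT r 1)
  rw [link_comm, u0_iff hT] at h
  tauto

/-- The rail edge `2–3` of side `r` is used iff the top port of side `r` is not. [folklore] -/
theorem u2_iff (r : Bool) : Link T (rail r 2) (rail r 3) ↔ ¬ Link T (port r true) (rail r 0) := by
  have h := hT.link_iff_not_link_of_adj_three (rail_mem r 2) (nbr_rail2 r) (by simp) (by simp) (by simp)
    (rail_mid hT r 2)
  rw [link_comm, u1_iff hT] at h
  tauto

/-- The bottom port of side `r` is used iff the top port is. [folklore] -/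
theorem b_iff (r : Bool) : Link T (rail r 3) (port r false) ↔ Link T (port r true) (rail r 0) := by
  have h := hT.link_iff_not_link_of_adj_three (rail_mem r 3) (nbr_rail3 r) (by simp) (by simp) (by simp)
    (rail_mid hT r 3)
  rw [link_comm, u2_iff hT] at h
  tauto

/-- Links at `rail r 0` when the top port of side `r` is used. [folklore] -/
theorem links_rail0_of (r : Bool) (ha : Link T (port r true) (rail r 0)) {y : LadderV} (hy : Link T (rail r 0) y) :
    y = mid 0 ∨ y = port r true := by
  rcases nbr_rail0 r y (hT.adj_of_link hy) with rfl | rfl | rfl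
  · exact Or.inl rfl
  · exact absurd hy ((u0_iff hT r).not_left.2 ha)
  · exact Or.inr rfl

/-- Links at `rail r 0` when the top port of side `r` is not used. [folklore] -/
theorem links_rail0_of_not (r : Bool) (ha : ¬ Link T (port r true) (rail r 0)) {y : LadderV}
    (hy : Link T (rail r 0) y) : y = mid 0 ∨ y = rail r 1 := by
  rcases nbr_rail0 r y (hT.adj_of_link hy) with rfl | rfl | rfl
  · exact Or.inl rfl
  · exact Or.inr rfl
  · exact absurd (link_comm.1 hy) ha

/-- Links at `rail r 1` when the top port of side `r` is used. [folklore] -/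
theorem links_rail1_of (r : Bool) (ha : Link T (port r true) (rail r 0)) {y : LadderV} (hy : Link T (rail r 1) y) :
    y = mid 1 ∨ y = rail r 2 := by
  rcases nbr_rail1 r y (hT.adj_of_link hy) with rfl | rfl | rfl
  · exact Or.inl rfl
  · exact absurd (link_comm.1 hy) ((u0_iff hT r).not.2 (not_not.2 ha))
  · exact Or.inr rfl

/-- Links at `rail r 1` when the top port of side `r` is not used. [folklore] -/
theorem links_rail1_of_not (r : Bool) (ha : ¬ Link T (port r true) (rail r 0)) {y : LadderV}
    (hy : Link T (rail r 1) y) : y = mid 1 ∨ y = rail r 0 := by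
  rcases nbr_rail1 r y (hT.adj_of_link hy) with rfl | rfl | rfl
  · exact Or.inl rfl
  · exact Or.inr rfl
  · exact absurd ((u1_iff hT r).1 hy) ha

/-- Links at `rail r 2` when the top port of side `r` is used. [folklore] -/
theorem links_rail2_of (r : Bool) (ha : Link T (port r true) (rail r 0)) {y : LadderV} (hy : Link T (rail r 2) y) :
    y = mid 2 ∨ y = rail r 1 := by
  rcases nbr_rail2 r y (hT.adj_of_link hy) with rfl | rfl | rfl
  · exact Or.inl rfl
  · exact Or.inr rfl
  · exact absurd hy ((u2_iff hT r).not_left.2 ha)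

/-- Links at `rail r 2` when the top port of side `r` is not used. [folklore] -/
theorem links_rail2_of_not (r : Bool) (ha : ¬ Link T (port r true) (rail r 0)) {y : LadderV}
    (hy : Link T (rail r 2) y) : y = mid 2 ∨ y = rail r 3 := by
  rcases nbr_rail2 r y (hT.adj_of_link hy) with rfl | rfl | rfl
  · exact Or.inl rfl
  · exact absurd ((u1_iff hT r).1 (link_comm.1 hy)) ha
  · exact Or.inr rfl

/-- Links at `rail r 3` when the top port of side `r` is used. [folklore] -/
theorem links_rail3_of (r : Bool) (ha : Link T (port r true) (rail r 0)) {y : LadderV} (hy : Link T (rail r 3) y) :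
    y = mid 3 ∨ y = port r false := by
  rcases nbr_rail3 r y (hT.adj_of_link hy) with rfl | rfl | rfl
  · exact Or.inl rfl
  · exact absurd (link_comm.1 hy) ((u2_iff hT r).not_left.2 ha)
  · exact Or.inr rfl

/-- Links at `rail r 3` when the top port of side `r` is not used. [folklore] -/
theorem links_rail3_of_not (r : Bool) (ha : ¬ Link T (port r true) (rail r 0)) {y : LadderV}
    (hy : Link T (rail r 3) y) : y = mid 3 ∨ y = rail r 2 := by
  rcases nbr_rail3 r y (hT.adj_of_link hy) with rfl | rfl | rfl
  · exact Or.inl rfl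
  · exact Or.inr rfl
  · exact absurd ((b_iff hT r).1 hy) ha

/-- **Not both sides can be entered**: otherwise the middle rungs and the middle rail edges form
a closed hexagon. [folklore] -/
theorem not_both (hf : Link T (port false true) (rail false 0)) (ht : Link T (port true true) (rail true 0)) : False := by
  have ha : ∀ r, Link T (port r true) (rail r 0) := fun r => by cases r <;> assumption
  refine hT.not_closed (C := {v | (∃ r, v = rail r 1 ∨ v = rail r 2) ∨ v = mid 1 ∨ v = mid 2}) ?_ ?_
    (x := mid 1) (Or.inr (Or.inl rfl))
  · rintro u (⟨r, rfl | rfl⟩ | rfl | rfl) v hv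
    · rcases links_rail1_of hT r (ha r) hv with rfl | rfl
      · exact Or.inr (Or.inl rfl)
      · exact Or.inl ⟨r, Or.inr rfl⟩
    · rcases links_rail2_of hT r (ha r) hv with rfl | rfl
      · exact Or.inr (Or.inr rfl)
      · exact Or.inl ⟨r, Or.inl rfl⟩
    · rcases (mid_links hT 1).2.2 v hv with rfl | rfl
      · exact Or.inl ⟨false, Or.inl rfl⟩
      · exact Or.inl ⟨true, Or.inl rfl⟩
    · rcases (mid_links hT 2).2.2 v hv with rfl | rfl
      · exact Or.inl ⟨false, Or.inr rfl⟩
      · exact Or.inl ⟨true, Or.inr rfl⟩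
  · rintro u (⟨r, rfl | rfl⟩ | rfl | rfl)
    · exact rail_mem r 1
    · exact rail_mem r 2
    · exact mid_mem 1
    · exact mid_mem 2

/-- **Some side is entered** (the ports of the family are ports of the ladder). [folklore] -/
theorem some_side (hP : ∀ p ∈ P, isPort p = true) : ∃ r, Link T (port r true) (rail r 0) := by
  obtain ⟨p, hp, h, hph, -⟩ := hT.reach (mid_mem 0)
  obtain ⟨r, t, rfl⟩ := eq_port_of_isPort (hP p hp)
  refine ⟨r, ?_⟩
  cases t
  · have := nbr_port_bot r h (hT.adj_of_link hph)
    subst this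
    exact (b_iff hT r).1 (link_comm.1 hph)
  · have := nbr_port_top r h (hT.adj_of_link hph)
    subst this
    exact hph

/-- **The strand entering side `r` is the zigzag of side `r`** (forced walk). [folklore] -/
theorem forced (r : Bool) (ha : Link T (port r true) (rail r 0)) (hna : ¬ Link T (port (!r) true) (rail (!r) 0))
    {τ : LadderV × List LadderV × LadderV} (hτ : τ ∈ T) :
    (τ.1 = port r true → τ = (port r true, zigzag r, port r false)) ∧
      (τ.2.2 = port r true → τ = (port r false, (zigzag r).reverse, port r true)) := by
  refine hT.eq_of_forced (p₀ := port r true) (p₁ := port r false) (ws := zigzag r) (by simp [zigzag])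
    (by cases r <;> decide) (port_not_mem r false) (fun y hy => ?_) (fun i hi y hy => ?_) hτ
  · have := nbr_port_top r y (hT.adj_of_link hy)
    subst this
    simp [zigzag]
  · have hi' : i < 12 := by simp [zigzag] at hi; omega
    interval_cases i <;>
      simp only [zigzag, List.cons_append, List.nil_append, List.getElem_cons_succ, List.getElem_cons_zero] at hy ⊢
    · exact (links_rail0_of hT r ha hy).symm
    · rcases (mid_links hT 0).2.2 y hy with rfl | rfl <;> cases r <;> simp
    · exact links_rail0_of_not hT (!r) hna hy
    · exact (links_rail1_of_not hT (!r) hna hy).symm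
    · rcases (mid_links hT 1).2.2 y hy with rfl | rfl <;> cases r <;> simp
    · exact links_rail1_of hT r ha hy
    · exact (links_rail2_of hT r ha hy).symm
    · rcases (mid_links hT 2).2.2 y hy with rfl | rfl <;> cases r <;> simp
    · exact links_rail2_of_not hT (!r) hna hy
    · exact (links_rail3_of_not hT (!r) hna hy).symm
    · rcases (mid_links hT 3).2.2 y hy with rfl | rfl <;> cases r <;> simp
    · exact links_rail3_of hT r ha hy

/-- The family when side `r` is entered: the single zigzag of side `r`. [folklore] -/
theorem family_eq_of (r : Bool) (ha : Link T (port r true) (rail r 0))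
    (hna : ¬ Link T (port (!r) true) (rail (!r) 0)) :
    T = {(port r true, zigzag r, port r false)} ∨ T = {(port r false, (zigzag r).reverse, port r true)} := by
  obtain ⟨τ, hτ, hend⟩ := hT.exists_end_of_link_port (port_not_mem r true) ha
  have key := forced hT r ha hna hτ
  have hall : (∀ x ∈ ladderVX, x ∈ τ.2.1) → T = {τ} := fun h => by
    ext σ
    simp only [Set.mem_singleton_iff]
    exact ⟨fun hσ => hT.eq_of_forall_mem hτ h hσ, fun h => h ▸ hτ⟩
  rcases hend with h1 | h2
  · have := key.1 h1
    subst this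
    exact Or.inl (hall (by cases r <;> decide))
  · have := key.2 h2
    subst this
    exact Or.inr (hall (by cases r <;> decide))

/-- **Classification of the strand families of the ladder**: the zigzag of one side, in one of
its two orientations. [folklore] -/
theorem family_classification (hP : ∀ p ∈ P, isPort p = true) :
    ∃ r, T = {(port r true, zigzag r, port r false)} ∨ T = {(port r false, (zigzag r).reverse, port r true)} := by
  obtain ⟨r₀, hr₀⟩ := some_side hT hP
  by_cases hf : Link T (port false true) (rail false 0) <;> by_cases ht : Link T (port true true) (rail true 0)
  · exact (not_both hT hf ht).elim
  · exact ⟨false, family_eq_of hT false hf (by simpa using ht)⟩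
  · exact ⟨true, family_eq_of hT true ht (by simpa using hf)⟩
  · cases r₀
    · exact absurd hr₀ hf
    · exact absurd hr₀ ht

end analysis

/-! ### Exclusivity and census -/

/-- **The subdivided ladder is an exclusive gadget.** [folklore] -/
theorem exclusive : Exclusive ladderG ladderVX ladderS := by
  refine exclusive_of_strandFamily (fun p hp => ?_) fun T hT τ hτ => ?_
  · rw [ports_ladderS] at hp
    simp only [Finset.mem_insert, Finset.mem_singleton] at hp
    rcases hp with rfl | rfl | rfl | rfl <;> exact port_not_mem _ _
  · obtain ⟨r, h | h⟩ := family_classification hT (fun p hp => by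
      rw [ports_ladderS] at hp
      simp only [Finset.mem_insert, Finset.mem_singleton] at hp
      rcases hp with rfl | rfl | rfl | rfl <;> rfl)
    · rw [h, Set.mem_singleton_iff] at hτ
      subst hτ
      cases r
      · exact Or.inl (by simp [ladderS, slot])
      · exact Or.inl (by simp [ladderS, slot])
    · rw [h, Set.mem_singleton_iff] at hτ
      subst hτ
      cases r
      · exact Or.inr (by simp [ladderS, slot])
      · exact Or.inr (by simp [ladderS, slot])

/-- The zigzag cover realises the slot of its side. [folklore] -/
theorem isCover_coverOf (r : Bool) : IsCover ladderG ladderVX {slot r} (coverOf r) := by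
  refine ⟨fun e he => ?_, fun e he => ?_, fun e he e' he' hne => ?_, fun x hx => ⟨slot r, Finset.mem_singleton_self _, ?_⟩⟩
  · rw [Finset.mem_singleton] at he
    subst he
    rw [coverOf, if_pos rfl]
    cases r <;> exact ⟨by simp [zigzag], by decide, by decide, by decide⟩
  · rw [Finset.mem_singleton] at he
    rw [coverOf, if_neg he]
  · rw [Finset.mem_singleton] at he he'
    exact absurd (he.trans he'.symm) hne
  · rw [coverOf, if_pos rfl]
    revert x
    cases r <;> decide

/-- **The covers realising one slot: exactly the zigzag.** [folklore] -/
theorem coverSet_single (r : Bool) : coverSet ladderG ladderVX {slot r} = {coverOf r} := by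
  ext f
  simp only [coverSet, Set.mem_setOf_eq, Set.mem_singleton_iff]
  constructor
  · intro hf
    have hfam := strandFamily_coverFamily hf (fun e he => by
        rw [Finset.mem_singleton] at he; subst he; cases r <;> decide)
      (fun e he e' he' hne => by
        rw [Finset.mem_singleton] at he he'; exact absurd (he.trans he'.symm) hne)
      (fun p hp => by
        rw [ports_single] at hp
        simp only [Finset.mem_insert, Finset.mem_singleton] at hp
        rcases hp with rfl | rfl <;> exact port_not_mem _ _)
    obtain ⟨r', hcl⟩ := family_classification hfam (fun p hp => by
      rw [ports_single] at hp
      simp only [Finset.mem_insert, Finset.mem_singleton] at hp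
      rcases hp with rfl | rfl <;> rfl)
    -- the member `(port r true, f (slot r), port r false)` of the cover family
    have hmem : (port r true, f (slot r), port r false) ∈ coverFamily {slot r} f :=
      ⟨slot r, Finset.mem_singleton_self _, rfl⟩
    have hval : f (slot r) = zigzag r := by
      rcases hcl with h | h <;> rw [h, Set.mem_singleton_iff] at hmem <;> simp only [Prod.mk.injEq] at hmem
      · obtain ⟨h1, h2, -⟩ := hmem
        cases r <;> cases r' <;> simp_all
      · obtain ⟨h1, -, -⟩ := hmem
        cases r <;> cases r' <;> simp at h1
    funext e
    by_cases he : e = slot r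
    · subst he; rw [hval, coverOf, if_pos rfl]
    · rw [coverOf, if_neg he, hf.2.1 e (by rwa [Finset.mem_singleton])]
  · rintro rfl
    exact isCover_coverOf r

/-- **Census: one cover per slot.** [folklore] -/
theorem coverCount_single (r : Bool) : coverCount ladderG ladderVX {slot r} = 1 := by
  rw [coverCount, coverSet_single, Set.ncard_singleton]

/-- **Census: no cover realising no slot** (the gadget is not empty). [folklore] -/
theorem coverCount_empty : coverCount ladderG ladderVX ∅ = 0 := by
  have h : coverSet ladderG ladderVX ∅ = ∅ := by
    ext f
    simp only [coverSet, Set.mem_setOf_eq, Set.mem_empty_iff_false, iff_false]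
    intro hf
    obtain ⟨e, he, -⟩ := hf.2.2.2 (mid 0) (mid_mem 0)
    simp at he
  rw [coverCount, h, Set.ncard_empty]

/-- **Census: no cover realising both slots.** [folklore] -/
theorem coverCount_pair : coverCount ladderG ladderVX ladderS = 0 := by
  suffices h : coverSet ladderG ladderVX ladderS = ∅ by rw [coverCount, h, Set.ncard_empty]
  ext f
  simp only [coverSet, Set.mem_setOf_eq, Set.mem_empty_iff_false, iff_false]
  intro hf
  have hfam := strandFamily_coverFamily hf (fun e he => by
      simp only [ladderS, Finset.mem_insert, Finset.mem_singleton] at he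
      rcases he with rfl | rfl <;> decide)
    (fun e he e' he' hne => by
      simp only [ladderS, Finset.mem_insert, Finset.mem_singleton] at he he'
      rcases he with rfl | rfl <;> rcases he' with rfl | rfl
      · exact absurd rfl hne
      · simp [slot]
      · simp [slot]
      · exact absurd rfl hne)
    (fun p hp => by
      rw [ports_ladderS] at hp
      simp only [Finset.mem_insert, Finset.mem_singleton] at hp
      rcases hp with rfl | rfl | rfl | rfl <;> exact port_not_mem _ _)
  obtain ⟨r', hcl⟩ := family_classification hfam (fun p hp => by
    rw [ports_ladderS] at hp
    simp only [Finset.mem_insert, Finset.mem_singleton] at hp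
    rcases hp with rfl | rfl | rfl | rfl <;> rfl)
  have h0 : (port false true, f (slot false), port false false) ∈ coverFamily ladderS f :=
    ⟨slot false, by simp [ladderS], rfl⟩
  have h1 : (port true true, f (slot true), port true false) ∈ coverFamily ladderS f :=
    ⟨slot true, by simp [ladderS], rfl⟩
  rcases hcl with h | h <;> rw [h, Set.mem_singleton_iff] at h0 h1 <;> simp only [Prod.mk.injEq] at h0 h1
  · obtain ⟨h0, -⟩ := h0
    obtain ⟨h1, -⟩ := h1
    cases r' <;> simp at h0 h1
  · obtain ⟨h0, -⟩ := h0
    obtain ⟨h1, -⟩ := h1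
    cases r' <;> simp at h0 h1

/-- **The census of the subdivided ladder** on the subsets of its slots: `1` on the two
singletons, `0` on `∅` and on both. [folklore] -/
theorem coverCount_eq (U : Finset (LadderV × LadderV)) (hU : U ⊆ ladderS) :
    coverCount ladderG ladderVX U = if U = {slot false} ∨ U = {slot true} then 1 else 0 := by
  have hcases : U = ∅ ∨ U = {slot false} ∨ U = {slot true} ∨ U = ladderS := by
    have hmem : ∀ e ∈ U, e = slot false ∨ e = slot true := fun e he => by
      simpa [ladderS] using hU he
    by_cases h0 : slot false ∈ U <;> by_cases h1 : slot true ∈ U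
    · refine Or.inr (Or.inr (Or.inr ?_))
      ext e
      simp only [ladderS, Finset.mem_insert, Finset.mem_singleton]
      exact ⟨hmem e, by rintro (rfl | rfl) <;> assumption⟩
    · refine Or.inr (Or.inl ?_)
      ext e
      simp only [Finset.mem_singleton]
      exact ⟨fun he => (hmem e he).resolve_right (fun h => h1 (h ▸ he)), fun h => h ▸ h0⟩
    · refine Or.inr (Or.inr (Or.inl ?_))
      ext e
      simp only [Finset.mem_singleton]
      exact ⟨fun he => (hmem e he).resolve_left (fun h => h0 (h ▸ he)), fun h => h ▸ h1⟩
    · refine Or.inl (Finset.eq_empty_of_forall_notMem fun e he => ?_)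
      rcases hmem e he with rfl | rfl
      · exact h0 he
      · exact h1 he
  rcases hcases with rfl | rfl | rfl | rfl
  · rw [coverCount_empty, if_neg (by decide)]
  · rw [coverCount_single, if_pos (Or.inl rfl)]
  · rw [coverCount_single, if_pos (Or.inr rfl)]
  · rw [coverCount_pair, if_neg (by decide)]

end Ladder

end Literature.Combinatorics.SimpleGraph
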